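import Literature.AlgebraicGeometry.HodgeTheory.QuaternionicQuarticFermatMemberChartThree
import HarnessLib

/-!
# The Fermat member: exactness of the chart data `(α, N) = (e, 1)` and the complete nodality package

Layer `Literature/AlgebraicGeometry/HodgeTheory`, namespace `Literature.AlgebraicGeometry.HodgeTheory.Q8Family`. Theorems only (no
definition, no named fact). Written by the prover seat `leafhand-hodge-q8symplecticpowers-4` (g5, cell `pub-hsemireg`), part (T2c) —
the last part — of target (T2) «one explicit nodal member for every even `e`» of memo NINTH-HAND-S1-DESIGN-leafhand4-g5 (route
`HodgeConjecture/Q8SymplecticPowers`, crux K1Q, stmt-HodgeConjecture-24190, stub S1).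

`IsChartExact e 1 G₂` asks, besides the support bounds (`bounds_planeG₂_fermatParam`), for a monomial of `G₂ = (s³ − s)·y·Ψ₂` of
`y`-degree exactly `e` and one of pole order exactly `1`; the monomial `s^{2e+1} y^{e} = s³y · (s²y)^{e−1}` serves for both, with
coefficient `1`: the only contributions to this coefficient come from `s³y · (s²y − 2)^{e−1}` (the term `sy · Ψ₂` has pole order `≤ −1`,
`(y − 2)^{e−1}` and `1` have no `s`), and the coefficient of `(s²y)^{d}` in `(s²y − 2)^{d}` is `1` (induction on `d`).
Consequently **the whole nodality package `hNod` of `Q8SymplecticPowersRegularOfNodalBranchCurve.stub_regularVeryGeneralQ_of_nodalDoubleCoverFact`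
holds at the explicit parameter `a = fermatParam e` for every even `e ≥ 4`** (`fermatParam_nodalPackage`) — the nodal locus of the
S1 programme is NON-EMPTY; what S1c still needs is its Zariski-openness (memo (T3)), to meet every `D(g)`.
Honest scope: explicit algebra; nothing here bears on HC; S1 ∕ K1Q NOT proved here.

References: [Hartshorne1977] V.2 (ruled surfaces: `div` of `s`, `y` on `𝔽₂`); [Zariski1929]; [Naie2007] §1.2.
-/

noncomputable section

open MvPolynomial
open Literature.AlgebraicGeometry.PlaneCurves.AffineNodalCurves Literature.AlgebraicGeometry.Surfaces.HirzebruchTwoDoublePlane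

namespace Literature.AlgebraicGeometry.HodgeTheory.Q8Family

/-! ### The leading coefficient of `(s²y − 2)^d` -/

/-- The exponent `(2d, d)` of `(s²y)^d`. [folklore] -/
private theorem smul_sq_exp (d : ℕ) :
    d • (Finsupp.single 0 2 + Finsupp.single 1 1 : Fin 2 →₀ ℕ) = Finsupp.single 0 (2 * d) + Finsupp.single 1 d := by
  ext i
  fin_cases i <;> simp [mul_comm]

/-- **The coefficient of `(s²y)^d` in `(s²y − 2)^d` is `1`.** [cite: Hartshorne1977, V.2 (ruled surfaces)] -/
theorem coeff_sqY_sub_two_pow (d : ℕ) :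
    coeff (Finsupp.single 0 (2 * d) + Finsupp.single 1 d) ((X 0 ^ 2 * X 1 - C 2 : MvPolynomial (Fin 2) ℂ) ^ d) = 1 := by
  classical
  induction d with
  | zero => simp
  | succ k ih =>
    have hA : (X 0 ^ 2 * X 1 : MvPolynomial (Fin 2) ℂ) = monomial (Finsupp.single 0 2 + Finsupp.single 1 1) 1 := by
      rw [X_pow_eq_monomial, X, monomial_mul, mul_one]
    rw [pow_succ, mul_sub, coeff_sub, hA, coeff_mul_monomial', if_pos (by
      intro i; fin_cases i <;> simp), mul_one, ← hA,
      show (X 0 ^ 2 * X 1 - C 2 : MvPolynomial (Fin 2) ℂ) ^ k * C 2 = C 2 * (X 0 ^ 2 * X 1 - C 2) ^ k from mul_comm _ _,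
      coeff_C_mul]
    have hsub : (Finsupp.single 0 (2 * (k + 1)) + Finsupp.single 1 (k + 1) : Fin 2 →₀ ℕ) -
        (Finsupp.single 0 2 + Finsupp.single 1 1) = Finsupp.single 0 (2 * k) + Finsupp.single 1 k := by
      ext i
      fin_cases i <;> simp
      omega
    rw [hsub, ih]
    -- the second term vanishes: `y`-degree of `(s²y − 2)^k` is `≤ k < k + 1`
    have h0 : coeff (Finsupp.single 0 (2 * (k + 1)) + Finsupp.single 1 (k + 1)) ((X 0 ^ 2 * X 1 - C 2 : MvPolynomial (Fin 2) ℂ) ^ k) = 0 := by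
      rw [← notMem_support_iff]
      intro hm
      have h := yBound_pow yBound_sqY_sub_two k _ hm
      simp at h
    rw [h0, mul_zero, sub_zero]

/-- `(y − 2)^d` has no monomial of positive `s`-degree. [cite: Hartshorne1977, V.2 (ruled surfaces)] -/
theorem coeff_Y_sub_two_pow_eq_zero (d : ℕ) {m : Fin 2 →₀ ℕ} (hm : 0 < m 0) :
    coeff m ((X 1 - C 2 : MvPolynomial (Fin 2) ℂ) ^ d) = 0 := by
  classical
  rw [← notMem_support_iff]
  intro h
  have h1 := monomial_le_degreeOf 0 h
  have h2 : degreeOf 0 ((X 1 - C 2 : MvPolynomial (Fin 2) ℂ) ^ d) = 0 := by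
    apply Nat.eq_zero_of_le_zero
    calc degreeOf 0 ((X 1 - C 2 : MvPolynomial (Fin 2) ℂ) ^ d) ≤ d * degreeOf 0 (X 1 - C 2 : MvPolynomial (Fin 2) ℂ) :=
          degreeOf_pow_le _ _ _
      _ ≤ d * 0 := by
          refine Nat.mul_le_mul_left d ?_
          calc degreeOf 0 (X 1 - C 2 : MvPolynomial (Fin 2) ℂ) ≤ max (degreeOf 0 (X 1 : MvPolynomial (Fin 2) ℂ))
                (degreeOf 0 (C 2 : MvPolynomial (Fin 2) ℂ)) := degreeOf_sub_le _ _ _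
            _ = 0 := by rw [degreeOf_X_of_ne (by decide), degreeOf_C, max_self]
      _ = 0 := by simp
  omega

/-- **The coefficient of `s^{2e+1} y^{e}` in `G₂` is `1`** (`e ≥ 2`). [cite: Hartshorne1977, V.2 (ruled surfaces)] -/
theorem coeff_top_planeG₂_fermatParam {e : ℕ} (he : 2 ≤ e) :
    coeff (Finsupp.single 0 (2 * e + 1) + Finsupp.single 1 e) (planeG₂ (fermatParam e) 1) = 1 := by
  classical
  obtain ⟨d, hd⟩ : ∃ d, e = d + 1 := ⟨e - 1, by omega⟩
  have hd' : e - 1 = d := by omega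
  rw [planeG₂_fermatParam_factor, hd']
  -- `(s³ − s) y = s³y − sy` as monomials
  have hc : (X 0 * (X 0 - 1) * (X 0 + 1) * X 1 : MvPolynomial (Fin 2) ℂ) =
      monomial (Finsupp.single 0 3 + Finsupp.single 1 1) 1 - monomial (Finsupp.single 0 1 + Finsupp.single 1 1) 1 := by
    have h3 : (monomial (Finsupp.single 0 3 + Finsupp.single 1 1) 1 : MvPolynomial (Fin 2) ℂ) = X 0 ^ 3 * X 1 := by
      rw [X_pow_eq_monomial, X, monomial_mul, mul_one]
    have h1 : (monomial (Finsupp.single 0 1 + Finsupp.single 1 1) 1 : MvPolynomial (Fin 2) ℂ) = X 0 * X 1 := by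
      rw [X, X, monomial_mul, mul_one]
    rw [h3, h1]; ring
  rw [hc, sub_mul, coeff_sub, coeff_monomial_mul', coeff_monomial_mul', if_pos (by
    rw [hd]; intro i; fin_cases i <;> simp), if_pos (by rw [hd]; intro i; fin_cases i <;> simp), one_mul, one_mul]
  have hs1 : (Finsupp.single 0 (2 * e + 1) + Finsupp.single 1 e : Fin 2 →₀ ℕ) - (Finsupp.single 0 3 + Finsupp.single 1 1) =
      Finsupp.single 0 (2 * d) + Finsupp.single 1 d := by
    rw [hd]; ext i; fin_cases i <;> simp
    omega
  have hs2 : (Finsupp.single 0 (2 * e + 1) + Finsupp.single 1 e : Fin 2 →₀ ℕ) - (Finsupp.single 0 1 + Finsupp.single 1 1) =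
      Finsupp.single 0 (2 * d + 2) + Finsupp.single 1 d := by
    rw [hd]; ext i; fin_cases i <;> simp
    omega
  rw [hs1, hs2]
  -- coefficients of `Ψ₂ = (s²y−2)^d + (y−2)^d + 1`
  simp only [coeff_add]
  rw [coeff_sqY_sub_two_pow, coeff_Y_sub_two_pow_eq_zero d (by simp; omega), coeff_Y_sub_two_pow_eq_zero d (by simp),
    coeff_one, if_neg (by
      intro h
      have := DFunLike.congr_fun h 1
      simp at this
      omega), coeff_one, if_neg (by
      intro h
      have := DFunLike.congr_fun h 0
      simp at this)]
  -- the `sy · (s²y − 2)^d` contribution vanishes: pole order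
  have h0 : coeff (Finsupp.single 0 (2 * d + 2) + Finsupp.single 1 d) ((X 0 ^ 2 * X 1 - C 2 : MvPolynomial (Fin 2) ℂ) ^ d) = 0 := by
    rw [← notMem_support_iff]
    intro hm
    have h := poleBound_pow poleBound_sqY_sub_two d _ hm
    simp at h
  rw [h0]
  ring

/-- **`IsChartExact e 1 G₂` for the Fermat member** (`e ≥ 2`): `α = e` is the exact `y`-degree and `N = 1` the exact pole order.
[cite: Hartshorne1977, V.2 (ruled surfaces)] -/
theorem isChartExact_planeG₂_fermatParam {e : ℕ} (he : 2 ≤ e) : IsChartExact e 1 (planeG₂ (fermatParam e) 1) := by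
  have hmem : (Finsupp.single 0 (2 * e + 1) + Finsupp.single 1 e : Fin 2 →₀ ℕ) ∈ (planeG₂ (fermatParam e) 1).support := by
    rw [mem_support_iff, coeff_top_planeG₂_fermatParam he]
    exact one_ne_zero
  refine ⟨bounds_planeG₂_fermatParam (by omega), ⟨_, hmem, by simp⟩, ⟨_, hmem, by simp; ring⟩⟩

/-! ### The complete package at the Fermat member -/

/-- **(T2) The nodality package `hNod` holds at the explicit parameter `a = fermatParam e`** (with `α = e`, `N = 1`) for every even
`e ≥ 4`: exact chart data, and the branch curve of the double plane is nodal in all four charts of `𝔽₂`. (This is the clause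
`∃ α N, …` of the hypothesis `hNod` of `Q8SymplecticPowersRegularOfNodalBranchCurve.stub_regularVeryGeneralQ_of_nodalDoubleCoverFact`,
stated with its `dinv = (a₀² − a₁²)⁻¹`, which is `1` here.) [cite: Zariski1929] [cite: Hartshorne1977, V.2 (ruled surfaces)]
[cite: Fulton2008, §3.1 (nodes)] -/
theorem fermatParam_nodalPackage {e : ℕ} (he : Even e) (h4 : 4 ≤ e) :
    ∃ α N : ℕ, Even α ∧ 2 ≤ α ∧
      IsChartExact α N (planeG₂ (fermatParam e) (coefLin (fermatParam e) 0 ^ 2 - coefLin (fermatParam e) 1 ^ 2)⁻¹) ∧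
      IsNodal (planeG₂ (fermatParam e) (coefLin (fermatParam e) 0 ^ 2 - coefLin (fermatParam e) 1 ^ 2)⁻¹) ∧
      IsNodal (X 0 ^ (N % 2) * chartTwo N (planeG₂ (fermatParam e) (coefLin (fermatParam e) 0 ^ 2 - coefLin (fermatParam e) 1 ^ 2)⁻¹)) ∧
      IsNodal (chartThree α (planeG₂ (fermatParam e) (coefLin (fermatParam e) 0 ^ 2 - coefLin (fermatParam e) 1 ^ 2)⁻¹)) ∧
      IsNodal (X 0 ^ (N % 2) * chartFour α N
        (planeG₂ (fermatParam e) (coefLin (fermatParam e) 0 ^ 2 - coefLin (fermatParam e) 1 ^ 2)⁻¹)) := by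
  rw [det_fermatParam, inv_one]
  obtain ⟨hb, h1, h2, h3, h4'⟩ := isNodal_fermatParam_allCharts he h4
  exact ⟨e, 1, he, by omega, isChartExact_planeG₂_fermatParam (by omega), h1, h2, h3, h4'⟩

end Literature.AlgebraicGeometry.HodgeTheory.Q8Family

end
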